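import Summits.QuantumFields.YangMills.Theorems.IsotropyFromPowerCountingTemperedCurvatureMomentsDegreeTwo

/-!
# Chart selection for three points of `ℝ⁴` — part 1 (elementary lemmas)

Stub `stub_chartSelection` of reshape 4 of `Cruxes/TemperedCurvatureMoments/Lines/Sketch.lean`
(crux stmt-QuantumFields-17721), support file.  Pure finite-dimensional geometry of the sixteen
lattice mirrors of `ℝ⁴` (axis mirrors `±e_μ`, diagonal mirrors `(±e_μ ± e_ν)/√2`); no quantum field
theory enters.

Contents (all elementary, [folklore]):
* `exists_scale` — ladder pigeonhole: for `36` real numbers `Δ i j μ` and a length `d > 0` there is a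
  scale `θ ∈ [8⁻³⁶/2, 1/2]` such that no `Δ i j μ` lies in `[θ d / 8, θ d)` (the `37` intervals
  `[8^{-m-1} d/2, 8^{-m} d/2)`, `m = 0, …, 36`, are pairwise disjoint).
* `exists_min_dist`, `exists_coord_ge_half_dist` — the minimal pairwise distance of an injective
  triple, and a coordinate carrying half the Euclidean distance.
* `inner_smul_single`, `inner_single_one`, `inner_diag` — projections onto `s e_μ` and onto
  `(s e_μ + s' e_ν)/√2` in coordinates.
* `cover3`, `third3` — bookkeeping on `Fin 3`.
* `axis_good` — a slot lying `≥ M` above a slot which lies `≥ M` above the third slot, along an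
  oriented axis, satisfies the AXIS clause of `stub_chartSelection` with any margin `m ∈ [0, M]`.
* `diag_good` — a slot `k` which is `a`-extreme in coordinate `μ` (sign `s`) and admits, in every
  coordinate `ν`, a sign `s'_ν` with `s'_ν (y_k^ν - y_i^ν) ≥ -b` for both other slots, satisfies the
  DIAGONAL clause with margin `m` whenever `0 ≤ m`, `2m ≤ a - b`: the frames
  `n_ν = (s e_μ + s'_ν e_ν)/√2` isolate `y_k`, and `n_{ν₁}, v_{ν₁}, n_{ν₂}, n_{ν₃}` are linearly
  independent.
-/

noncomputable section

namespace Summit.QuantumFields.YangMills.Theorems.TemperedCurvatureMoments.Sketch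

open scoped BigOperators
open Summit.QuantumFields.YangMills.Theorems.NPointIsotropy.Negative (E4)

namespace ChartSelection

/-! ## The scale: ladder pigeonhole -/

/-- **Ladder pigeonhole.**  For `36` reals `Δ i j μ` (`i j : Fin 3`, `μ : Fin 4`) and `d > 0` there is
a scale `θ` with `8⁻³⁶/2 ≤ θ ≤ 1/2` such that every `Δ i j μ` is either `< θ d / 8` or `≥ θ d`: the
`37` pairwise disjoint intervals `[8^{-m} d/16, 8^{-m} d/2)`, `m ≤ 36`, cannot all be occupied.
[folklore] -/
theorem exists_scale (Δ : Fin 3 → Fin 3 → Fin 4 → ℝ) {d : ℝ} (hd : 0 < d) :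
    ∃ θ : ℝ, (1 / 8 : ℝ) ^ 36 / 2 ≤ θ ∧ θ ≤ 1 / 2 ∧
      ∀ i j μ, Δ i j μ < θ / 8 * d ∨ θ * d ≤ Δ i j μ := by
  by_contra hcon
  push Not at hcon
  have key : ∀ m : Fin 37, ∃ p : Fin 3 × Fin 3 × Fin 4,
      (1 / 8 : ℝ) ^ (m : ℕ) / 2 / 8 * d ≤ Δ p.1 p.2.1 p.2.2 ∧
        Δ p.1 p.2.1 p.2.2 < (1 / 8 : ℝ) ^ (m : ℕ) / 2 * d := by
    intro m
    have hm : (m : ℕ) ≤ 36 := Nat.lt_succ_iff.1 m.is_lt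
    have hlow : (1 / 8 : ℝ) ^ 36 ≤ (1 / 8 : ℝ) ^ (m : ℕ) :=
      pow_le_pow_of_le_one (by norm_num) (by norm_num) hm
    have hone : (1 / 8 : ℝ) ^ (m : ℕ) ≤ 1 := pow_le_one₀ (by norm_num) (by norm_num)
    obtain ⟨i, j, μ, h1, h2⟩ :=
      hcon ((1 / 8 : ℝ) ^ (m : ℕ) / 2) (by linarith) (by linarith)
    exact ⟨(i, j, μ), h1, h2⟩
  choose f hf using key
  have aux : ∀ a b : Fin 37, (a : ℕ) < b → f a ≠ f b := by
    intro a b hab hfab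
    have h1 := (hf a).1
    have h2 := (hf b).2
    rw [hfab] at h1
    have hpow : (1 / 8 : ℝ) ^ (b : ℕ) ≤ (1 / 8 : ℝ) ^ (a : ℕ) * (1 / 8) := by
      rw [← pow_succ]
      exact pow_le_pow_of_le_one (by norm_num) (by norm_num) (Nat.succ_le_of_lt hab)
    have h3 := mul_le_mul_of_nonneg_right hpow hd.le
    linarith
  have hinj : Function.Injective f := by
    intro a b hab
    by_contra hne
    rcases lt_or_gt_of_ne (fun h : (a : ℕ) = b => hne (Fin.ext h)) with h | h
    · exact aux a b h hab
    · exact aux b a h hab.symm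
  have hcard := Fintype.card_le_of_injective f hinj
  simp [Fintype.card_prod, Fintype.card_fin] at hcard

/-! ## Distances and coordinates -/

/-- The minimal pairwise distance of an injective triple: positive, below every pairwise distance,
and attained. [folklore] -/
theorem exists_min_dist (y : Fin 3 → E4) (hy : Function.Injective y) :
    ∃ d : ℝ, 0 < d ∧ (∀ i j, i ≠ j → d ≤ dist (y i) (y j)) ∧
      ∃ i j, i ≠ j ∧ dist (y i) (y j) ≤ d := by
  haveI : Nonempty {p : Fin 3 × Fin 3 // p.1 ≠ p.2} := ⟨⟨((0 : Fin 3), (1 : Fin 3)), by decide⟩⟩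
  obtain ⟨⟨⟨i₀, j₀⟩, hne⟩, hmin⟩ :=
    Finite.exists_min (fun p : {p : Fin 3 × Fin 3 // p.1 ≠ p.2} => dist (y p.1.1) (y p.1.2))
  exact ⟨dist (y i₀) (y j₀), dist_pos.2 (hy.ne hne), fun i j hij => hmin ⟨(i, j), hij⟩,
    i₀, j₀, hne, le_rfl⟩

/-- Some coordinate of `x - z` carries at least half of the Euclidean distance (`ℝ⁴` has four
coordinates). [folklore] -/
theorem exists_coord_ge_half_dist (x z : E4) : ∃ μ : Fin 4, dist x z / 2 ≤ |x μ - z μ| := by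
  by_contra h
  push Not at h
  have hsq : dist x z ^ 2 = ∑ μ, (x μ - z μ) ^ 2 := by
    rw [EuclideanSpace.dist_sq_eq]
    exact Finset.sum_congr rfl fun μ _ => by rw [Real.dist_eq, sq_abs]
  have hlt : ∀ μ, (x μ - z μ) ^ 2 < (dist x z / 2) ^ 2 := fun μ => by
    have h1 := abs_lt.1 (h μ)
    exact sq_lt_sq' h1.1 h1.2
  rw [Fin.sum_univ_four] at hsq
  nlinarith [hlt 0, hlt 1, hlt 2, hlt 3]

/-- Projection onto an oriented axis `s e_μ` in coordinates. [folklore] -/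
theorem inner_smul_single (x : E4) (μ : Fin 4) (s : ℝ) :
    inner ℝ x (s • (EuclideanSpace.single μ (1 : ℝ) : E4)) = s * x μ := by
  rw [real_inner_smul_right, EuclideanSpace.inner_single_right, one_mul, conj_trivial]

/-- Projection onto the axis `e_μ` in coordinates. [folklore] -/
theorem inner_single_one (x : E4) (μ : Fin 4) :
    inner ℝ x (EuclideanSpace.single μ (1 : ℝ) : E4) = x μ := by
  rw [EuclideanSpace.inner_single_right, one_mul, conj_trivial]

/-- Projection onto a diagonal direction `(s e_μ + s' e_ν)/√2` in coordinates. [folklore] -/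
theorem inner_diag (x : E4) (μ ν : Fin 4) (s s' : ℝ) :
    inner ℝ x ((Real.sqrt 2)⁻¹ • (s • (EuclideanSpace.single μ (1 : ℝ) : E4) +
      s' • (EuclideanSpace.single ν (1 : ℝ) : E4))) = (Real.sqrt 2)⁻¹ * (s * x μ + s' * x ν) := by
  rw [real_inner_smul_right, inner_add_right, inner_smul_single, inner_smul_single]

/-- Three pairwise distinct elements of `Fin 3` exhaust it. [folklore] -/
theorem cover3 : ∀ a b c : Fin 3, a ≠ b → a ≠ c → b ≠ c → ∀ x : Fin 3, x = a ∨ x = b ∨ x = c := by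
  decide

/-- Two distinct elements of `Fin 3` leave a third. [folklore] -/
theorem third3 : ∀ a b : Fin 3, a ≠ b → ∃ c : Fin 3, a ≠ c ∧ b ≠ c := by
  decide

/-! ## The axis clause -/

/-- **Axis clause from an ordered chain.**  If along the oriented axis `s e_μ` the slot `a` lies `≥ M`
above the slot `k`, which lies `≥ M` above the slot `i` (`{a, k, i} = Fin 3`), then `a` satisfies the
axis clause of `stub_chartSelection` in the frame `(μ, s)` with every margin `0 ≤ m ≤ M`.
[folklore] -/
theorem axis_good (y : Fin 3 → E4) {a k i : Fin 3} (hcov : ∀ b, b = a ∨ b = k ∨ b = i)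
    (μ : Fin 4) {s m M : ℝ} (hs : s = 1 ∨ s = -1) (hmM : m ≤ M) (hm0 : 0 ≤ m)
    (h1 : M ≤ s * (y a μ - y k μ)) (h2 : M ≤ s * (y k μ - y i μ)) :
    ∃ (μ : Fin 4) (s : ℝ), (s = 1 ∨ s = -1) ∧
      (∀ i, i ≠ a → inner ℝ (y i) (s • (EuclideanSpace.single μ (1 : ℝ) : E4)) + m ≤
        inner ℝ (y a) (s • (EuclideanSpace.single μ (1 : ℝ) : E4))) ∧
      (∀ i i', i ≠ a → i' ≠ a → i ≠ i' →
        m ≤ |inner ℝ (y i) (EuclideanSpace.single μ (1 : ℝ) : E4) -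
          inner ℝ (y i') (EuclideanSpace.single μ (1 : ℝ) : E4)|) := by
  have hsabs : ∀ x : ℝ, s * x ≤ |x| := fun x => by
    rcases hs with h | h
    · rw [h, one_mul]; exact le_abs_self x
    · rw [h, neg_one_mul]; exact neg_le_abs x
  rw [mul_sub] at h1 h2
  refine ⟨μ, s, hs, fun b hb => ?_, fun b b' hb hb' hbb' => ?_⟩
  · rw [inner_smul_single, inner_smul_single]
    rcases hcov b with rfl | rfl | rfl
    · exact absurd rfl hb
    · linarith
    · linarith
  · rw [inner_single_one, inner_single_one]
    have hki : m ≤ |y k μ - y i μ| :=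
      le_trans (by linarith) (le_trans (le_of_eq (mul_sub s (y k μ) (y i μ)).symm) (hsabs _))
    rcases hcov b with rfl | rfl | rfl
    · exact absurd rfl hb
    · rcases hcov b' with rfl | rfl | rfl
      · exact absurd rfl hb'
      · exact absurd rfl hbb'
      · exact hki
    · rcases hcov b' with rfl | rfl | rfl
      · exact absurd rfl hb'
      · rw [abs_sub_comm]; exact hki
      · exact absurd rfl hbb'

/-! ## The diagonal clause -/

/-- **Diagonal clause from one extreme coordinate.**  Let the slot `k` be `a`-extreme in coordinate
`μ` with sign `s` (`s (y_k^μ - y_i^μ) ≥ a` for `i ≠ k`), and suppose every coordinate `ν` admits a sign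
`s'_ν` with `s'_ν (y_k^ν - y_i^ν) ≥ -b` for `i ≠ k`.  Then for `0 ≤ m`, `2 m ≤ a - b`, the slot `k`
satisfies the diagonal clause of `stub_chartSelection` with margin `m`: each time direction
`n_ν = (s e_μ + s'_ν e_ν)/√2` (`ν ≠ μ`) isolates `y_k` by `(a - b)/√2 ≥ m`, and with `ν₀ ≠ μ` the four
directions `t_μ = v_{ν₀}` (the in-plane partner of `n_{ν₀}`), `t_ν = n_ν` (`ν ≠ μ`) are linearly
independent. [folklore] -/
theorem diag_good (y : Fin 3 → E4) (k : Fin 3) (μ : Fin 4) {s a b m : ℝ} (hs : s = 1 ∨ s = -1)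
    (hm0 : 0 ≤ m) (hm : 2 * m ≤ a - b)
    (hμ : ∀ i, i ≠ k → a ≤ s * (y k μ - y i μ))
    (hν : ∀ ν : Fin 4, ∃ s' : ℝ, (s' = 1 ∨ s' = -1) ∧ ∀ i, i ≠ k → -b ≤ s' * (y k ν - y i ν)) :
    ∃ t : Fin 4 → E4, LinearIndependent ℝ t ∧ ∀ j, ∃ n v : E4, (∃ (μ ν : Fin 4) (s s' : ℝ),
      μ ≠ ν ∧ (s = 1 ∨ s = -1) ∧ (s' = 1 ∨ s' = -1) ∧
      n = (Real.sqrt 2)⁻¹ • (s • (EuclideanSpace.single μ (1 : ℝ) : E4) +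
        s' • (EuclideanSpace.single ν (1 : ℝ) : E4)) ∧
      v = (Real.sqrt 2)⁻¹ • (s • (EuclideanSpace.single μ (1 : ℝ) : E4) -
        s' • (EuclideanSpace.single ν (1 : ℝ) : E4))) ∧ (t j = n ∨ t j = v) ∧
      ∀ i, i ≠ k → inner ℝ (y i) n + m ≤ inner ℝ (y k) n := by
  choose sg hsg hsgb using hν
  obtain ⟨ν₀, hν₀⟩ := exists_ne μ
  -- the frames
  set nn : Fin 4 → E4 := fun ν => (Real.sqrt 2)⁻¹ • (s • (EuclideanSpace.single μ (1 : ℝ) : E4) +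
    sg ν • (EuclideanSpace.single ν (1 : ℝ) : E4)) with hnn
  set vv : E4 := (Real.sqrt 2)⁻¹ • (s • (EuclideanSpace.single μ (1 : ℝ) : E4) -
    sg ν₀ • (EuclideanSpace.single ν₀ (1 : ℝ) : E4)) with hvv
  set t : Fin 4 → E4 := fun j => if j = μ then vv else nn j with ht
  have ht_eq : t μ = vv := by simp [ht]
  have ht_ne : ∀ j, j ≠ μ → t j = nn j := fun j hj => by simp [ht, hj]
  -- constants
  have hsq0 : 0 < Real.sqrt 2 := Real.sqrt_pos.2 (by norm_num)
  have hsqi : (Real.sqrt 2)⁻¹ ≠ 0 := inv_ne_zero hsq0.ne'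
  have hsg0 : ∀ j, sg j ≠ 0 := fun j => by rcases hsg j with h | h <;> rw [h] <;> norm_num
  have hs0 : s ≠ 0 := by rcases hs with h | h <;> rw [h] <;> norm_num
  have htwo : (2 : ℝ)⁻¹ ≤ (Real.sqrt 2)⁻¹ := by
    have h2 : Real.sqrt 2 ≤ 2 := by
      nlinarith [Real.sq_sqrt (show (0 : ℝ) ≤ 2 by norm_num), Real.sqrt_nonneg 2]
    exact inv_anti₀ hsq0 h2
  -- coordinates of the frame vectors
  have hnn_apply : ∀ j κ, nn j κ = (Real.sqrt 2)⁻¹ *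
      (s * (if κ = μ then 1 else 0) + sg j * (if κ = j then 1 else 0)) := by
    intro j κ
    simp only [hnn, PiLp.smul_apply, PiLp.add_apply, PiLp.single_apply, smul_eq_mul]
  have hvv_apply : ∀ κ, vv κ = (Real.sqrt 2)⁻¹ *
      (s * (if κ = μ then 1 else 0) - sg ν₀ * (if κ = ν₀ then 1 else 0)) := by
    intro κ
    simp only [hvv, PiLp.smul_apply, PiLp.sub_apply, PiLp.single_apply, smul_eq_mul]
  -- isolation of `y k` in every frame `nn ν`
  have hiso : ∀ ν i, i ≠ k → inner ℝ (y i) (nn ν) + m ≤ inner ℝ (y k) (nn ν) := by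
    intro ν i hi
    simp only [hnn]
    rw [inner_diag, inner_diag]
    have h1 := hμ i hi
    have h2 := hsgb ν i hi
    rw [mul_sub] at h1 h2
    have hD0 : 0 ≤ (s * y k μ + sg ν * y k ν) - (s * y i μ + sg ν * y i ν) := by linarith
    have h3 := mul_le_mul_of_nonneg_right htwo hD0
    linarith
  refine ⟨t, ?_, fun j => ?_⟩
  · -- linear independence, by coordinates
    rw [Fintype.linearIndependent_iff]
    intro g hg
    have hc : ∀ κ, ∑ j, g j * t j κ = 0 := fun κ => by
      have := congrArg (fun w : E4 => w κ) hg
      simpa using this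
    have hstep : ∀ κ, κ ≠ μ → κ ≠ ν₀ → g κ = 0 := by
      intro κ hκμ hκν
      have h := hc κ
      rw [Fintype.sum_eq_single κ (fun j hj => ?_)] at h
      · rw [ht_ne κ hκμ, hnn_apply, if_neg hκμ, if_pos rfl, mul_zero, zero_add, mul_one] at h
        exact (mul_eq_zero.1 h).resolve_right (mul_ne_zero hsqi (hsg0 κ))
      · by_cases hjμ : j = μ
        · rw [hjμ, ht_eq, hvv_apply, if_neg hκμ, if_neg hκν]; ring
        · rw [ht_ne j hjμ, hnn_apply, if_neg hκμ, if_neg (Ne.symm hj)]; ring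
    have hrest : ∀ j, j ≠ ν₀ ∧ j ≠ μ → g j * t j ν₀ = 0 := fun j hj => by
      rw [hstep j hj.2 hj.1, zero_mul]
    have hrest' : ∀ j, j ≠ ν₀ ∧ j ≠ μ → g j * t j μ = 0 := fun j hj => by
      rw [hstep j hj.2 hj.1, zero_mul]
    have h2 := hc ν₀
    rw [Fintype.sum_eq_add ν₀ μ hν₀ hrest, ht_ne ν₀ hν₀, ht_eq, hnn_apply, hvv_apply,
      if_neg hν₀, if_pos rfl] at h2
    have h3 := hc μ
    rw [Fintype.sum_eq_add ν₀ μ hν₀ hrest', ht_ne ν₀ hν₀, ht_eq, hnn_apply, hvv_apply,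
      if_pos rfl, if_neg (Ne.symm hν₀)] at h3
    have hA : ((Real.sqrt 2)⁻¹ * sg ν₀) * (g ν₀ - g μ) = 0 := by linear_combination h2
    have hB : ((Real.sqrt 2)⁻¹ * s) * (g ν₀ + g μ) = 0 := by linear_combination h3
    have hA' : g ν₀ - g μ = 0 := (mul_eq_zero.1 hA).resolve_left (mul_ne_zero hsqi (hsg0 ν₀))
    have hB' : g ν₀ + g μ = 0 := (mul_eq_zero.1 hB).resolve_left (mul_ne_zero hsqi hs0)
    intro i
    by_cases hiμ : i = μ
    · rw [hiμ]; linarith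
    · by_cases hiν : i = ν₀
      · rw [hiν]; linarith
      · exact hstep i hiμ hiν
  · -- the frame data at `j`
    by_cases hj : j = μ
    · refine ⟨nn ν₀, vv, ⟨μ, ν₀, s, sg ν₀, Ne.symm hν₀, hs, hsg ν₀, rfl, rfl⟩, Or.inr ?_, hiso ν₀⟩
      rw [hj, ht_eq]
    · exact ⟨nn j, (Real.sqrt 2)⁻¹ • (s • (EuclideanSpace.single μ (1 : ℝ) : E4) -
        sg j • (EuclideanSpace.single j (1 : ℝ) : E4)), ⟨μ, j, s, sg j, Ne.symm hj, hs, hsg j, rfl,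
        rfl⟩, Or.inl (ht_ne j hj), hiso j⟩

end ChartSelection

end Summit.QuantumFields.YangMills.Theorems.TemperedCurvatureMoments.Sketch

end
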